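import Summits.BirchSwinnertonDyer.Rank1Residual.X2.RouteGSplitDisplay80934e1Local
import Mathlib.Tactic.NormNum.LegendreSymbol
import HarnessLib

/-!
# Route G: NON-split multiplicative reduction at a LARGE prime by a Legendre-symbol certificate
# (cell `bsd-eis`, seat `bsd-eis-k5-c3` g2; THEOREMS ONLY, nothing booked)

HONEST FRAMING (FULL-BSD rank-≤1 programme D-0033, cell `bsd-eis`; row A10). The route-G part-1 files decide split
versus non-split multiplicative reduction at a bad prime `ℓ` of the integer model `E₀` through the node-tangent
quadratic `c₄ t² + a₁c₄ t − (54 b₆ − 3 b₂ b₄ + a₂ c₄)` over `𝔽_ℓ` (`multAt_of_intModel`,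
`X2/RouteGSplitDisplay80934e1Local.lean`): a root certifies SPLIT, root-freeness certifies NON-split — so far by
`decide` over all `t ∈ 𝔽_ℓ`, feasible only for small `ℓ`. Relatives found OUTSIDE Cremona's table (Hesse-pencil
members) have bad primes up to `10⁹`; for them root-freeness is certified here by ONE Legendre symbol: if the
discriminant `D = (a₁c₄)² + 4c₄(54 b₆ − 3 b₂ b₄ + a₂ c₄)` is a quadratic NON-residue mod `ℓ` (`legendreSym ℓ D = −1`,
evaluated by `norm_num`'s Jacobi-symbol extension through quadratic reciprocity), the quadratic has no root
(`(2c₄t + a₁c₄)² = D` at a root). [cite: SilvermanAEC2009, VII.5 Prop. 5.1(b)]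
-/

set_option autoImplicit false

namespace Summit.BirchSwinnertonDyer.Rank1Residual.X2.RouteGNodal

/-- **Root-freeness of the node-tangent quadratic from a Legendre symbol.** For an integer Weierstrass model `E₀`
and a prime `ℓ`: if `legendreSym ℓ ((a₁c₄)² + 4c₄(54b₆ − 3b₂b₄ + a₂c₄)) = −1` then
`c₄t² + a₁c₄t − (54b₆ − 3b₂b₄ + a₂c₄) ≠ 0` for every `t ∈ 𝔽_ℓ` — the hypothesis of the non-split clause of
`multAt_of_intModel` / `not_hasSplitMultiplicativeReductionAtPrime_of_intModel_of_noroot`, without enumerating `𝔽_ℓ`.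
[cite: SilvermanAEC2009, VII.5 Prop. 5.1(b)] -/
theorem nodal_noroot_of_legendreSym (E₀ : WeierstrassCurve ℤ) (ℓ : ℕ) [Fact ℓ.Prime]
    (hleg : legendreSym ℓ ((E₀.a₁ * E₀.c₄) ^ 2 + 4 * E₀.c₄ * (54 * E₀.b₆ - 3 * E₀.b₂ * E₀.b₄ + E₀.a₂ * E₀.c₄)) = -1) :
    ∀ t : ZMod ℓ, (E₀.c₄ : ZMod ℓ) * t ^ 2 + (E₀.a₁ * E₀.c₄ : ZMod ℓ) * t
        - (54 * E₀.b₆ - 3 * E₀.b₂ * E₀.b₄ + E₀.a₂ * E₀.c₄ : ZMod ℓ) ≠ 0 := by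
  intro t ht
  have hsq : IsSquare ((((E₀.a₁ * E₀.c₄) ^ 2 + 4 * E₀.c₄ * (54 * E₀.b₆ - 3 * E₀.b₂ * E₀.b₄ + E₀.a₂ * E₀.c₄) : ℤ) :
      ZMod ℓ)) := by
    refine ⟨2 * (E₀.c₄ : ZMod ℓ) * t + (E₀.a₁ * E₀.c₄ : ZMod ℓ), ?_⟩
    push_cast
    linear_combination (-(4 : ZMod ℓ) * (E₀.c₄ : ZMod ℓ)) * ht
  exact (legendreSym.eq_neg_one_iff ℓ).mp hleg hsq

end Summit.BirchSwinnertonDyer.Rank1Residual.X2.RouteGNodal
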